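import Literature.Geometry.Riemannian.GurskyViaclovskyClosednessChartEquation
import HarnessLib

/-!
# The Gursky–Viaclovsky chart operator is a smooth function of frozen coefficients and the jet

Support file (everything PROVED; no definition, no named fact) for the named fact
`Literature.Geometry.Riemannian.gurskyViaclovsky_pathOpen_weighted_four`
(`GurskyViaclovskyOpenness.lean`). The chart operator of the weighted `σ₂` path equation,
`chartOperator G t W y p r = 2((tr_G 𝒜)² − |𝒜|²_G) − ¼W`, `𝒜 = gvForm G t y p r`
(`GurskyViaclovskyClosednessChartEquation.lean`; Gursky–Viaclovsky 2003, §1 (change1)–(PDE)),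
depends on the point `y` only through the values at `y` of four tensor fields of the components
`G` — the metric `G y`, the index-raising map `♯_y = (G y)⁻¹` (`MetricCoord.sharpAt`), the
Christoffel map `Γ_y` (`MetricCoord.chrAt`) and the Ricci form `Ric_y` (`MetricCoord.ricAt`;
`tr_G`, `|·|²_G` and `R = tr_G Ric` are traces of compositions with `♯_y`). Freezing these four
values as independent variables makes the operator, minus the zeroth-order term `Q e^{−4v}` of the
equation `F_t(w) = q e^{−4w}`, a GLOBALLY smooth function

  `𝒩 : ℝ × (coefficients) × (2-jet) → ℝ`,   coefficients `= (W, Q, G_y, ♯_y, Γ_y, Ric_y)`,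

polynomial in everything but `v` (where it is `e^{−4v}`) — no inverse is ever taken. This is the
structure function through which `w ↦ F_t(w) − q e^{−4w}` becomes a smooth map of Hölder spaces
(`Literature/Analysis/FunctionSpaces/HolderManifoldNemytskii.lean`), the first hypothesis of the
implicit function theorem in Gursky–Viaclovsky's openness step (§5).

* `exists_contDiff_chartStructure` — existence of such a smooth `𝒩` with
  `𝒩(t, (W, Q, G y, ♯_y, Γ_y, Ric_y), (v, p, r)) = chartOperator G t W y (−p) (−r) − Q e^{−4v}`
  (the signs: the chart operator is written in Gursky–Viaclovsky's `u = −w`).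

## References

* M. J. Gursky, J. A. Viaclovsky, J. Differential Geom. 63 (2003) 131–154, §1 and §5.
  [GurskyViaclovsky2003]
-/

noncomputable section

open Set Function
open scoped ContDiff Topology

namespace Literature.Geometry.Riemannian.GurskyViaclovskyPath

open Literature.Geometry.Lorentzian Literature.Geometry.Lorentzian.MetricCoord

-- spaces of iterated continuous linear maps need a deeper instance search
set_option maxSynthPendingDepth 3

variable {E : Type*} [NormedAddCommGroup E] [NormedSpace ℝ E] [FiniteDimensional ℝ E]

/-- The frozen metric trace `(S, β) ↦ tr(S ∘ β)` as an opaque smooth function. [folklore] -/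
theorem exists_contDiff_frozenTrace :
    ∃ f : ((E →L[ℝ] ℝ) →L[ℝ] E) × (E →L[ℝ] E →L[ℝ] ℝ) → ℝ, ContDiff ℝ ∞ f ∧
      ∀ S β, f (S, β) = LinearMap.trace ℝ E ((S.comp β : E →L[ℝ] E) : E →ₗ[ℝ] E) := by
  refine ⟨fun q => traceCLM E (q.1.comp q.2), ?_, fun S β => rfl⟩
  exact (traceCLM E).contDiff.comp (contDiff_fst.clm_comp contDiff_snd)

/-- The frozen metric square norm `(S, β) ↦ tr((S∘β)∘(S∘βᵗ))` as an opaque smooth function.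
[folklore] -/
theorem exists_contDiff_frozenNormSq :
    ∃ f : ((E →L[ℝ] ℝ) →L[ℝ] E) × (E →L[ℝ] E →L[ℝ] ℝ) → ℝ, ContDiff ℝ ∞ f ∧
      ∀ S β, f (S, β) = LinearMap.trace ℝ E
        ((((S.comp β).comp (S.comp β.flip)) : E →L[ℝ] E) : E →ₗ[ℝ] E) := by
  refine ⟨fun q => traceCLM E ((q.1.comp q.2).comp (q.1.comp q.2.flip)), ?_, fun S β => rfl⟩
  have hflip : ContDiff ℝ ∞ fun q : ((E →L[ℝ] ℝ) →L[ℝ] E) × (E →L[ℝ] E →L[ℝ] ℝ) => q.2.flip :=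
    (ContinuousLinearMap.flipₗᵢ ℝ E E ℝ).contDiff.comp contDiff_snd
  exact (traceCLM E).contDiff.comp
    ((contDiff_fst.clm_comp contDiff_snd).clm_comp (contDiff_fst.clm_comp hflip))

omit [FiniteDimensional ℝ E] in
/-- The frozen coordinate Hessian `(Γ, p, r) ↦ r − p ∘ Γ` as an opaque smooth function.
[folklore] -/
theorem exists_contDiff_frozenHess :
    ∃ f : (E →L[ℝ] E →L[ℝ] E) × ((E →L[ℝ] ℝ) × (E →L[ℝ] E →L[ℝ] ℝ)) → E →L[ℝ] E →L[ℝ] ℝ,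
      ContDiff ℝ ∞ f ∧
      ∀ Γ p r, f (Γ, p, r) = r - (ContinuousLinearMap.compL ℝ E E ℝ p).comp Γ := by
  refine ⟨fun q => q.2.2 - (ContinuousLinearMap.compL ℝ E E ℝ q.2.1).comp q.1, ?_,
    fun Γ p r => rfl⟩
  exact (contDiff_snd.comp contDiff_snd).sub
    (((ContinuousLinearMap.compL ℝ E E ℝ).contDiff.comp (contDiff_fst.comp contDiff_snd)).clm_comp
      contDiff_fst)

/-- **The chart operator as a globally smooth function of frozen coefficients and the jet.**
There is a `C^∞` function `𝒩` on `ℝ × (ℝ × ℝ × (E →L E →L ℝ) × (E* →L E) × (E →L E →L E) ×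
(E →L E →L ℝ)) × (ℝ × E* × (E →L E →L ℝ))` such that, for every field of components `G`, every
point `y` and all `t, W, Q, v, p, r`,
`𝒩 (t, (W, Q, G y, ♯_y, Γ_y, Ric_y), (v, p, r)) = chartOperator G t W y (−p) (−r) − Q e^{−4v}`
(`♯_y = sharpAt G y`, `Γ_y = chrAt G y`, `Ric_y = ricAt G y`). [cite: GurskyViaclovsky2003, §1 (PDE)] -/
theorem exists_contDiff_chartStructure :
    ∃ 𝒩 : ℝ × ((ℝ × (ℝ × ((E →L[ℝ] E →L[ℝ] ℝ) × (((E →L[ℝ] ℝ) →L[ℝ] E) ×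
        ((E →L[ℝ] E →L[ℝ] E) × (E →L[ℝ] E →L[ℝ] ℝ)))))) ×
        (ℝ × ((E →L[ℝ] ℝ) × (E →L[ℝ] E →L[ℝ] ℝ)))) → ℝ,
      ContDiff ℝ ∞ 𝒩 ∧
      ∀ (G : E → E →L[ℝ] E →L[ℝ] ℝ) (y : E) (t W Q v : ℝ) (p : E →L[ℝ] ℝ)
        (r : E →L[ℝ] E →L[ℝ] ℝ),
        𝒩 (t, (W, Q, G y, sharpAt G y, chrAt G y, ricAt G y), (v, p, r)) =
          chartOperator G t W y (-p) (-r) - Q * Real.exp (-4 * v) := by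
  obtain ⟨trF, htrF, trF_eq⟩ := exists_contDiff_frozenTrace (E := E)
  obtain ⟨nsF, hnsF, nsF_eq⟩ := exists_contDiff_frozenNormSq (E := E)
  obtain ⟨hsF, hhsF, hsF_eq⟩ := exists_contDiff_frozenHess (E := E)
  -- the frozen `gvForm`: `(t, Gy, S, Γ, Rc, p, r) ↦ 𝒜`
  obtain ⟨gvF, hgvF, gvF_eq⟩ : ∃ f : ℝ × ((E →L[ℝ] E →L[ℝ] ℝ) × (((E →L[ℝ] ℝ) →L[ℝ] E) ×
      ((E →L[ℝ] E →L[ℝ] E) × ((E →L[ℝ] E →L[ℝ] ℝ) × ((E →L[ℝ] ℝ) × (E →L[ℝ] E →L[ℝ] ℝ)))))) →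
        E →L[ℝ] E →L[ℝ] ℝ, ContDiff ℝ ∞ f ∧
      ∀ t Gy S Γ Rc p r, f (t, Gy, S, Γ, Rc, p, r) =
        (1 / 2 : ℝ) • (Rc - (t / 6 * trF (S, Rc)) • Gy) + hsF (Γ, p, r)
          + ((1 - t) / 2 * trF (S, hsF (Γ, p, r))) • Gy + p.smulRight p
          - ((2 - t) / 2 * p (S p)) • Gy := by
    refine ⟨fun q => (1 / 2 : ℝ) • (q.2.2.2.2.1 - (q.1 / 6 * trF (q.2.2.1, q.2.2.2.2.1)) • q.2.1)
        + hsF (q.2.2.2.1, q.2.2.2.2.2.1, q.2.2.2.2.2.2)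
        + ((1 - q.1) / 2 * trF (q.2.2.1, hsF (q.2.2.2.1, q.2.2.2.2.2.1, q.2.2.2.2.2.2))) • q.2.1
        + (q.2.2.2.2.2.1).smulRight q.2.2.2.2.2.1
        - ((2 - q.1) / 2 * q.2.2.2.2.2.1 (q.2.2.1 q.2.2.2.2.2.1)) • q.2.1, ?_,
      fun t Gy S Γ Rc p r => rfl⟩
    have ht : ContDiff ℝ ∞ fun q : ℝ × ((E →L[ℝ] E →L[ℝ] ℝ) × (((E →L[ℝ] ℝ) →L[ℝ] E) ×
        ((E →L[ℝ] E →L[ℝ] E) × ((E →L[ℝ] E →L[ℝ] ℝ) × ((E →L[ℝ] ℝ) × (E →L[ℝ] E →L[ℝ] ℝ)))))) =>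
        q.1 := by fun_prop
    have hGy : ContDiff ℝ ∞ fun q : ℝ × ((E →L[ℝ] E →L[ℝ] ℝ) × (((E →L[ℝ] ℝ) →L[ℝ] E) ×
        ((E →L[ℝ] E →L[ℝ] E) × ((E →L[ℝ] E →L[ℝ] ℝ) × ((E →L[ℝ] ℝ) × (E →L[ℝ] E →L[ℝ] ℝ)))))) =>
        q.2.1 := by fun_prop
    have hS : ContDiff ℝ ∞ fun q : ℝ × ((E →L[ℝ] E →L[ℝ] ℝ) × (((E →L[ℝ] ℝ) →L[ℝ] E) ×
        ((E →L[ℝ] E →L[ℝ] E) × ((E →L[ℝ] E →L[ℝ] ℝ) × ((E →L[ℝ] ℝ) × (E →L[ℝ] E →L[ℝ] ℝ)))))) =>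
        q.2.2.1 := by fun_prop
    have hΓ : ContDiff ℝ ∞ fun q : ℝ × ((E →L[ℝ] E →L[ℝ] ℝ) × (((E →L[ℝ] ℝ) →L[ℝ] E) ×
        ((E →L[ℝ] E →L[ℝ] E) × ((E →L[ℝ] E →L[ℝ] ℝ) × ((E →L[ℝ] ℝ) × (E →L[ℝ] E →L[ℝ] ℝ)))))) =>
        q.2.2.2.1 := by fun_prop
    have hRc : ContDiff ℝ ∞ fun q : ℝ × ((E →L[ℝ] E →L[ℝ] ℝ) × (((E →L[ℝ] ℝ) →L[ℝ] E) ×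
        ((E →L[ℝ] E →L[ℝ] E) × ((E →L[ℝ] E →L[ℝ] ℝ) × ((E →L[ℝ] ℝ) × (E →L[ℝ] E →L[ℝ] ℝ)))))) =>
        q.2.2.2.2.1 := by fun_prop
    have hp : ContDiff ℝ ∞ fun q : ℝ × ((E →L[ℝ] E →L[ℝ] ℝ) × (((E →L[ℝ] ℝ) →L[ℝ] E) ×
        ((E →L[ℝ] E →L[ℝ] E) × ((E →L[ℝ] E →L[ℝ] ℝ) × ((E →L[ℝ] ℝ) × (E →L[ℝ] E →L[ℝ] ℝ)))))) =>
        q.2.2.2.2.2.1 := by fun_prop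
    have hr : ContDiff ℝ ∞ fun q : ℝ × ((E →L[ℝ] E →L[ℝ] ℝ) × (((E →L[ℝ] ℝ) →L[ℝ] E) ×
        ((E →L[ℝ] E →L[ℝ] E) × ((E →L[ℝ] E →L[ℝ] ℝ) × ((E →L[ℝ] ℝ) × (E →L[ℝ] E →L[ℝ] ℝ)))))) =>
        q.2.2.2.2.2.2 := by fun_prop
    have hsr : ContDiff ℝ ∞ fun q : (E →L[ℝ] ℝ) × (E →L[ℝ] ℝ) => q.1.smulRight q.2 :=
      isBoundedBilinearMap_smulRight.contDiff
    have happ : ContDiff ℝ ∞ fun q : (E →L[ℝ] ℝ) × E => q.1 q.2 :=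
      isBoundedBilinearMap_apply.contDiff
    have happ' : ContDiff ℝ ∞ fun q : ((E →L[ℝ] ℝ) →L[ℝ] E) × (E →L[ℝ] ℝ) => q.1 q.2 :=
      isBoundedBilinearMap_apply.contDiff
    fun_prop
  -- the structure function
  refine ⟨fun z => 2 * (trF (z.2.1.2.2.2.1, gvF (z.1, z.2.1.2.2.1, z.2.1.2.2.2.1, z.2.1.2.2.2.2.1,
      z.2.1.2.2.2.2.2, -z.2.2.2.1, -z.2.2.2.2)) ^ 2 -
      nsF (z.2.1.2.2.2.1, gvF (z.1, z.2.1.2.2.1, z.2.1.2.2.2.1, z.2.1.2.2.2.2.1,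
        z.2.1.2.2.2.2.2, -z.2.2.2.1, -z.2.2.2.2))) - 1 / 4 * z.2.1.1 -
      z.2.1.2.1 * Real.exp (-4 * z.2.2.1), ?_, fun G y t W Q v p r => ?_⟩
  · -- smoothness
    have hexp : ContDiff ℝ ∞ Real.exp := Real.contDiff_exp
    fun_prop
  · -- the identity with the chart operator: unfold the frozen operations
    simp only [trF_eq, nsF_eq, gvF_eq, hsF_eq]
    rfl

end Literature.Geometry.Riemannian.GurskyViaclovskyPath

end
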